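import Mathlib
import HarnessLib
import Summits.HubbardSuperconductivity.HubbardSuperconductivity.Theorems.KLProgrammeKLRegimeSplitTwoLegVolumeRateATDoor
import Summits.HubbardSuperconductivity.HubbardSuperconductivity.Theorems.KLProgrammeKLRegimeSplitTwoLegCoreTDTube
import Summits.HubbardSuperconductivity.HubbardSuperconductivity.Theorems.KLProgrammeKLRegimeSplitTwoLegThresholdsExplicit
import Summits.HubbardSuperconductivity.HubbardSuperconductivity.Theorems.KLProgrammeKLRegimeEngineV8DefsU4

/-!
# K3 ENGINE child `KLRegimeEngineV16` (stmt-HubbardSuperconductivity-20236, skeleton v3-α 9747d23d14535406), stub (e) `stub_twoLeg_step`: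
# the CONSUMER-SIDE ASSEMBLY DOOR for `TwoLegStepV16 … (n+1)` at the inductive scales, under the stub's literal binders

Cell gate-hubbard-kl, seat hubbard-kl-r2d-p1 (g4); plan g15 START-HERE (KL STATUS 2026-08-27T08:41:42Z).  Stub (e) of the registered skeleton
concludes, for `1 ≤ n ≤ nScales β + 1` in the KL regime and under the public history `HistP klPredsV16 … n` and the scale-`n` engine bounds
`EngineBoundsAtV10S … n`, the two-leg slot of the gen-6 bundle

  `TwoLegStepV16 L M klEngGeo5 P (klEngQ5 P R) R β U μ K n`
    `= TwoLegCoreTD (histV15 …) … n ∧ TwoLegSizesMSTQ … n ∧ TwoLegVolumeRateAT (histV15 ∧ TwoLegCoreTD ∧ TwoLegSizesMSTQ) … n`  (`…SplitBundleV16` l.57).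

This file composes the three LANDED consumer theorems of the three conjuncts at scale `n + 1` — (A) p1b's TUBE-KEYED capped-core closer
`KLRegimeSplit.twoLegCoreTD_succ_of_tubeSizes_stub7` (…TwoLegCoreTDTube, p516528: every hypothesis chain-free — curve sizes, tube gradients, near
responses, value sizes; the global-size closers `…_of_momentumSizes_stub6'` are superseded per k3c5-p1 g7 STATUS 07:54:22Z / p1b 09:05:02Z),
(B) `TwoLegSizesMSTQ … (n+1)` BY NAME (the MS-lane suppliers are plugged in the sequel file), (C) k3c4-p1's nested-legs door `KLRegimeSplit.twoLegStepV16_of_cores_of_nestedLegs` (…TwoLegVolumeRateATDoor) —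
under EXACTLY the binders of `stub_twoLeg_step` (package `klEngGeo5 / klEngQ5 P R / klEngC₃3 P R / klEngU₀4 P R c / klEngL₃ / klEngM₃`), discharging the
threshold conversions (`klEngC₃3 ≤ klCurveC3/16`, `klEngU₀4 ≤ klEngU₀3 ≤ klCurveU0/16`, for the MS consumers of the sequel) and the sign
`0 ≤ (klEngQ5 P R).CL β (n+1)` here, so that every
hypothesis left over is a NAMED scale-`(n+1)` export of the engine lanes (the RESIDUAL TABLE of the STATUS line that lands this file):

* §1 bookkeeping: `klEngC₃3_le_klCurveC3_div_sixteen`, `klEngU₀3_le_klCurveU0_div_sixteen`, `klEngQ5_CL_nonneg`;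
* §2 `twoLegStepV16_of_namedCores_stub` — the slot from the two cores BY NAME + the two nested-leg rates (any scale `n`);
* §3 **`twoLegStepV16_succ_of_tubeSizes_stub`** — (A) opened: the slot at `n + 1` from p1b's CURVE sizes `Mv k` (k ≤ 2) of the increment at the Fermi
  points, a tube gradient `bΔ` on `{|frameLevel μ K| ≤ d}`, the NEAR response modulus `ρΔ`, the comparison frames' value sizes, the shell field strength
  and a shell-tube gradient `m₁'` of the K-separated reading, four fits; (B) by name; (C) the two nested-leg rates;
* the sequel `…EngineTwoLegStepSuccDoorMS` opens (B) as well (`twoLegStepV16_succ_of_tubeSizes_of_pieces_mixed_stub` through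
  `twoLegSizesMSTQ_succ_of_pieces_mixed` — no low-part hypothesis — and `twoLegStepV16_top_of_tubeSizes_stub` through `twoLegSizesMSTQ_top_of_frameOK`).

Proofs only (compositions of landed theorems + threshold arithmetic); no definitions; nothing about the model is asserted.
References: BGM 2006 §2.4 (2.36), §3 [cite: BenfattoGiulianiMastropietro2006]; cell files HOME/STATUS.md l.2319 (START-HERE), l.2318 ((R23) v3-α).
-/

noncomputable section

namespace Summit.HubbardSuperconductivity.HubbardSuperconductivity.Theorems.EngineV8

set_option linter.dupNamespace false -- summit = problem name (single-conjunct summit), D-0017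

open Real Finset Literature.MathematicalPhysics.QuantumLattice Literature.Probability.LatticeModels
open Literature.MathematicalPhysics.QuantumLattice.FermiRG Literature.MathematicalPhysics.QuantumLattice.BandSectorCounting
open Summit.HubbardSuperconductivity.HubbardSuperconductivity.Theorems.KLProgrammeLegKernels
open Summit.HubbardSuperconductivity.HubbardSuperconductivity.Theorems.DispersionFlow
open Summit.HubbardSuperconductivity.HubbardSuperconductivity.Theorems.PerturbedFermiCurve
open Summit.HubbardSuperconductivity.HubbardSuperconductivity.Theorems.KLRegimeSplit

/-! ## §1 Threshold bookkeeping under the stub's binders -/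

/-- **The engine's regime threshold is below a SIXTEENTH of the curve threshold**: `klEngC₃3 P R ≤ klCurveC3 R / 16` (the MS-lane consumers of
`…TwoLegSizesMSQ` are keyed to `c ≤ klCurveC3 R / 16`). -/
theorem klEngC₃3_le_klCurveC3_div_sixteen (P : SplitConsts) {R : RenConsts} (hR : ∀ j, 0 ≤ R.Gfr j) :
    klEngC₃3 P R ≤ klCurveC3 R / 16 := by
  unfold klEngC₃3 klCurveC3
  rw [klCurveKappa_eq_fifth]
  have hP := one_le_klEngPsq P
  have hRs : 1 + R.Gfr 2 ^ 2 ≤ klEngRsq R := by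
    unfold klEngRsq
    have : R.Gfr 2 ^ 2 ≤ ∑ j ∈ range 5, R.Gfr j ^ 2 :=
      Finset.single_le_sum (f := fun j => R.Gfr j ^ 2) (fun j _ => sq_nonneg _) (by simp)
    nlinarith [sq_nonneg R.cr, sq_nonneg R.cz]
  have hg := hR 2
  have hRs1 : 1 ≤ klEngRsq R := one_le_klEngRsq R
  have hden : 0 < (2 : ℝ) ^ 120 * klEngPsq P * klEngRsq R ^ 2 := by positivity
  rw [div_div, div_le_div_iff₀ hden (by positivity), one_mul]
  have h1 : (1 + R.Gfr 2) / 2 ≤ 1 + R.Gfr 2 ^ 2 := by nlinarith [sq_nonneg (R.Gfr 2 - 1 / 2)]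
  have h2 : klEngRsq R ≤ klEngRsq R ^ 2 := by nlinarith
  have h3 : (2 : ℝ) ^ 120 * klEngPsq P * klEngRsq R ^ 2 ≥ (2 : ℝ) ^ 120 * (1 + R.Gfr 2 ^ 2) := by
    have : klEngPsq P * klEngRsq R ^ 2 ≥ 1 * (1 + R.Gfr 2 ^ 2) := mul_le_mul hP (hRs.trans h2) (by positivity) (by positivity)
    nlinarith
  have h4 : (2 : ℝ) ^ 120 ≥ 384 := by norm_num
  nlinarith

/-- **The engine's coupling threshold is below a SIXTEENTH of the curve threshold**: `klEngU₀3 P R c ≤ klCurveU0 R / 16`. -/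
theorem klEngU₀3_le_klCurveU0_div_sixteen (P : SplitConsts) {R : RenConsts} (hR : ∀ j, 0 ≤ R.Gfr j) (c : ℝ) :
    klEngU₀3 P R c ≤ klCurveU0 R / 16 := by
  unfold klEngU₀3 klCurveU0
  rw [klCurveKappa_eq_fifth]
  have hP := one_le_klEngPsq P
  have hRs1 : 1 ≤ klEngRsq R := one_le_klEngRsq R
  have hRs : 1 + R.Gfr 0 ^ 2 + R.Gfr 1 ^ 2 ≤ klEngRsq R := by
    unfold klEngRsq
    have h0 : R.Gfr 0 ^ 2 + R.Gfr 1 ^ 2 ≤ ∑ j ∈ range 5, R.Gfr j ^ 2 := by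
      rw [Finset.sum_range_succ, Finset.sum_range_succ, Finset.sum_range_succ, Finset.sum_range_succ, Finset.sum_range_one]
      nlinarith [sq_nonneg (R.Gfr 2), sq_nonneg (R.Gfr 3), sq_nonneg (R.Gfr 4)]
    nlinarith [sq_nonneg R.cr, sq_nonneg R.cz]
  have hg0 := hR 0; have hg1 := hR 1
  have hden : 0 < (2 : ℝ) ^ 120 * klEngPsq P ^ 2 * klEngRsq R ^ 4 * (c ^ 2 + 1) := by positivity
  have hbig : (1 : ℝ) ≤ klEngPsq P ^ 2 * klEngRsq R ^ 4 * (c ^ 2 + 1) := by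
    have h1 : (1 : ℝ) ≤ klEngPsq P ^ 2 := one_le_pow₀ hP
    have h2 : (1 : ℝ) ≤ klEngRsq R ^ 4 := one_le_pow₀ hRs1
    have h3 : (1 : ℝ) ≤ c ^ 2 + 1 := by nlinarith [sq_nonneg c]
    calc (1 : ℝ) = 1 * 1 * 1 := by ring
      _ ≤ klEngPsq P ^ 2 * klEngRsq R ^ 4 * (c ^ 2 + 1) := by gcongr
  rw [← min_div_div_right (by norm_num : (0 : ℝ) ≤ 16)]
  refine le_min ?_ ?_
  · rw [div_le_div_iff₀ hden (by norm_num)]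
    have h16 : (16 : ℝ) ≤ 2 ^ 120 := by norm_num
    nlinarith
  · rw [div_div, div_div, div_le_div_iff₀ hden (by positivity)]
    simp only [one_mul]
    have h1 : (R.Gfr 0 + R.Gfr 1 + 1) / 2 ≤ 1 + R.Gfr 0 ^ 2 + R.Gfr 1 ^ 2 := by
      nlinarith [sq_nonneg (R.Gfr 0 - 1 / 2), sq_nonneg (R.Gfr 1 - 1 / 2)]
    have h2 : klEngRsq R ≤ klEngRsq R ^ 4 := by
      calc klEngRsq R = klEngRsq R ^ 1 := (pow_one _).symm
        _ ≤ klEngRsq R ^ 4 := pow_le_pow_right₀ hRs1 (by norm_num)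
    have h3 : (1 + R.Gfr 0 ^ 2 + R.Gfr 1 ^ 2) ≤ klEngPsq P ^ 2 * klEngRsq R ^ 4 * (c ^ 2 + 1) := by
      have hP2 : (1 : ℝ) ≤ klEngPsq P ^ 2 := one_le_pow₀ hP
      have hc2 : (1 : ℝ) ≤ c ^ 2 + 1 := by nlinarith [sq_nonneg c]
      calc (1 + R.Gfr 0 ^ 2 + R.Gfr 1 ^ 2) = 1 * (1 + R.Gfr 0 ^ 2 + R.Gfr 1 ^ 2) * 1 := by ring
        _ ≤ klEngPsq P ^ 2 * klEngRsq R ^ 4 * (c ^ 2 + 1) :=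
          mul_le_mul (mul_le_mul hP2 (hRs.trans h2) (by positivity) (by positivity)) hc2 (by positivity) (by positivity)
    have h4 : (2 : ℝ) ^ 120 ≥ 3840 := by norm_num
    nlinarith

/-- Under the stub's binders the regime constant is below a sixteenth of the curve threshold. -/
theorem le_klCurveC3_div_sixteen_of_le_klEngC₃3 {P : SplitConsts} {R : RenConsts} (hR : ∀ j, 0 ≤ R.Gfr j) {c : ℝ} (hc3 : c ≤ klEngC₃3 P R) :
    c ≤ klCurveC3 R / 16 :=
  hc3.trans (klEngC₃3_le_klCurveC3_div_sixteen P hR)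

/-- Under the stub's binders the coupling is below a sixteenth of the curve threshold. -/
theorem le_klCurveU0_div_sixteen_of_le_klEngU₀4 {P : SplitConsts} {R : RenConsts} (hR : ∀ j, 0 ≤ R.Gfr j) {c U : ℝ} (hUle : U ≤ klEngU₀4 P R c) :
    U ≤ klCurveU0 R / 16 :=
  (le_klEngU₀3_of_le_klEngU₀4 hUle).trans (klEngU₀3_le_klCurveU0_div_sixteen P hR c)

/-- The finite-volume budget of the engine's constants is nonnegative: `0 ≤ (klEngQ5 P R).CL β n`. -/
theorem klEngQ5_CL_nonneg (P : SplitConsts) (R : RenConsts) (β : ℝ) (n : ℕ) : 0 ≤ (klEngQ5 P R).CL β n :=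
  (klEngQ5_wf P R).2.2.2.2.2.2.2 β n

/-! ## §2 The slot from the two cores by name and the two nested-leg rates, at the stub's package -/

/-- **`TwoLegStepV16 … n` at the engine's package from its two cores BY NAME and the two nested legs** (k3c4-p1's door with `G := klEngGeo5`,
`Q := klEngQ5 P R`, the budget sign discharged): the shape every `stub_twoLeg_step` / `stub_twoLeg_scale0` closer ends in. -/
theorem twoLegStepV16_of_namedCores_stub {L M : ℕ} [NeZero L] [NeZero M] {P : SplitConsts} {R : RenConsts} {β U μ : ℝ} {K : TrigPolyC4v}
    {n : ℕ}
    (hcore : TwoLegCoreTD L M (histV15 L M klEngGeo5 P (klEngQ5 P R) R β U μ) klEngGeo5 P (klEngQ5 P R) R β U μ K n)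
    (hms : TwoLegSizesMSTQ L M klEngGeo5 (klEngQ5 P R) R β U μ K n)
    (hcut : ∀ (Mq : ℕ → ℕ) (L₁ M₁ M₂ : ℕ) [NeZero L₁] [NeZero M₁] [NeZero M₂], L ≤ L₁ → (klEngQ5 P R).M0 β L₁ ≤ M₁ → Mq L₁ ≤ M₁ → M₁ ≤ M₂ →
      (∀ j < n, histV15 L₁ M₁ klEngGeo5 P (klEngQ5 P R) R β U μ K j ∧
        TwoLegCoreTD L₁ M₁ (histV15 L₁ M₁ klEngGeo5 P (klEngQ5 P R) R β U μ) klEngGeo5 P (klEngQ5 P R) R β U μ K j ∧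
          TwoLegSizesMSTQ L₁ M₁ klEngGeo5 (klEngQ5 P R) R β U μ K j) →
      (∀ j < n, histV15 L₁ M₂ klEngGeo5 P (klEngQ5 P R) R β U μ K j ∧
        TwoLegCoreTD L₁ M₂ (histV15 L₁ M₂ klEngGeo5 P (klEngQ5 P R) R β U μ) klEngGeo5 P (klEngQ5 P R) R β U μ K j ∧
          TwoLegSizesMSTQ L₁ M₂ klEngGeo5 (klEngQ5 P R) R β U μ K j) →
        ∀ θ : ℝ, |klLocalPart L₁ M₁ β U μ K n θ - klLocalPart L₁ M₂ β U μ K n θ| ≤ (klEngQ5 P R).CL β n / 4 / L₁)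
    (hsp : ∀ (Mq : ℕ → ℕ) (L₁ L₂ M₂ : ℕ) [NeZero L₁] [NeZero L₂] [NeZero M₂], L ≤ L₁ → L₁ ∣ L₂ → (klEngQ5 P R).M0 β L₁ ≤ M₂ → Mq L₁ ≤ M₂ →
      (klEngQ5 P R).M0 β L₂ ≤ M₂ → Mq L₂ ≤ M₂ →
      (∀ j < n, histV15 L₁ M₂ klEngGeo5 P (klEngQ5 P R) R β U μ K j ∧
        TwoLegCoreTD L₁ M₂ (histV15 L₁ M₂ klEngGeo5 P (klEngQ5 P R) R β U μ) klEngGeo5 P (klEngQ5 P R) R β U μ K j ∧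
          TwoLegSizesMSTQ L₁ M₂ klEngGeo5 (klEngQ5 P R) R β U μ K j) →
      (∀ j < n, histV15 L₂ M₂ klEngGeo5 P (klEngQ5 P R) R β U μ K j ∧
        TwoLegCoreTD L₂ M₂ (histV15 L₂ M₂ klEngGeo5 P (klEngQ5 P R) R β U μ) klEngGeo5 P (klEngQ5 P R) R β U μ K j ∧
          TwoLegSizesMSTQ L₂ M₂ klEngGeo5 (klEngQ5 P R) R β U μ K j) →
        ∀ θ : ℝ, |klLocalPart L₁ M₂ β U μ K n θ - klLocalPart L₂ M₂ β U μ K n θ| ≤ (klEngQ5 P R).CL β n / 4 / L₁) :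
    TwoLegStepV16 L M klEngGeo5 P (klEngQ5 P R) R β U μ K n :=
  twoLegStepV16_of_cores_of_nestedLegs hcore hms (klEngQ5_CL_nonneg P R β n) hcut hsp

/-! ## §3 The door at `n + 1` with the core opened: p1b's TUBE-keyed data (curve sizes, tube gradients, near responses, value sizes, field strength) -/

/-- **THE ASSEMBLY DOOR OF `stub_twoLeg_step` AT SCALE `n + 1`, CORE OPENED (tube-keyed)** — under the stub's LITERAL binders (v3-α: `FrameOKDeg`,
`klEngU₀4`, `1 ≤ n+1 ≤ nScales β + 1`, KL regime, public history `HistP klPredsV16 … (n+1)`, scale-`(n+1)` engine bounds), the slot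
`TwoLegStepV16 L M klEngGeo5 P (klEngQ5 P R) R β U μ K (n+1)` follows from the NAMED residual exports:
(A) the inputs of p1b's `twoLegCoreTD_succ_of_tubeSizes_stub7` — `hMv`/`hfitS`: sizes `Mv k` (k ≤ 2) of the symmetrised interpolant of the local
self-energy INCREMENT at the Fermi points `k_F^K(θ)` and their fit into `twoLegBar … j (n+1)`; `hd`/`hbΔ`/`hg`: a gradient bound `bΔ` of the increment on
the tube `{|frameLevel μ K| ≤ d}`; `hr`: the NEAR (`frameDist K K′ ≤ d`) response modulus `ρΔ` against degree-capped comparison frames carrying the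
history at `(L, M)`; `hvK'`: the value size of every such comparison frame's own increment; `hfitL`/`hfar`: the two (E3c) fits; `hz`/`hm₁'`/`hfit1`: the
shell field strength, a gradient bound of the K-separated reading `I_L[σ_{n+1} − K∘p]` on the shell tube `{|frameLevel μ K| ≤ Λ_{n+1}}`, and the slopes fit;
(B) `hms` — `TwoLegSizesMSTQ … (n+1)` by name (MS lane; opened in the sequel `…TwoLegStepSuccDoorMS`); (C) `hcut`/`hsp` — the cutoff-leg and spatial-nested-leg rates of the local part
at scale `n+1` with quarter budget `(klEngQ5 P R).CL β (n+1)/4/L₁` (k3c4-p1's `twoLegStepV16_of_cores_of_nestedLegs`). -/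
theorem twoLegStepV16_succ_of_tubeSizes_stub (P : SplitConsts) (R : RenConsts) (c : ℝ) (hP : P.WF) (hR : R.WF2) (hc : 0 < c)
    (hc3 : c ≤ klEngC₃3 P R) (μ : ℝ) (hμ : μ ∈ klWindowC) (U : ℝ) (hU : 0 < U) (hUle : U ≤ klEngU₀4 P R c) (β : ℝ) (hβ : klBetaMin ≤ β)
    (hβc : β ≤ Real.exp (c / U ^ 2)) (K : TrigPolyC4v) (hK : FrameOKDeg R U (nScales β) μ K) (L M : ℕ) [NeZero L] [NeZero M]
    (hL : klEngL₃ β U ≤ L) (hM : klEngM₃ β U L ≤ M) (n : ℕ) (hn : n + 1 ≤ nScales β + 1) (hreg : IsKLRegime U c (-((n + 1 : ℕ) : ℤ)))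
    (hhist : HistP klPredsV16 L M klEngGeo5 P (klEngQ5 P R) R β U μ K (n + 1))
    (hE : EngineBoundsAtV10S L M klEngGeo5 P (klEngQ5 P R) β U μ K (n + 1))
    -- (A) the tube-keyed inputs of the core at scale `n + 1`
    {Mv : ℕ → ℝ}
    (hMv : ∀ k ≤ 2, ∀ θ : ℝ, ‖iteratedFDeriv ℝ k
      (evalM (symInterp L fun q => klLocSelfEnergyRe L M β U μ K (n + 1) q - klLocSelfEnergyRe L M β U μ K n q))
        (WithLp.toLp 2 (klFermiPoint μ K θ))‖ ≤ Mv k)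
    (hfitS : ∀ j ≤ 2, (if j = 0 then Mv 0 else 0) +
      (j.factorial : ℝ) ^ 2 * (2 * j.factorial * 1110 * 200 ^ j) *
        (if j = 0 then 2 * Mv 0 else (2 * π + 1) * (Mv 1 * klCurveD1) + (if j = 2 then Mv 2 * klCurveD1 ^ 2 + Mv 1 * klCurveD2 else 0)) *
        (4 + max 1 (((j - 1).factorial : ℝ) / (8 / 5))) ^ j ≤ twoLegBar klEngGeo5 (klEngQ5 P R) U j (n + 1))
    {d bΔ ρΔ : ℝ} (hd : 0 < d) (hbΔ : 0 ≤ bΔ)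
    (hg : ∀ q : Momentum, |frameLevel μ K q| ≤ d → ‖fderiv ℝ (fun q : Momentum =>
      evalM (symInterp L (klLocSelfEnergyRe L M β U μ K (n + 1))) q - evalM (symInterp L (klLocSelfEnergyRe L M β U μ K n)) q) q‖ ≤ bΔ)
    (hr : ∀ K' : TrigPolyC4v, FrameOKDeg R U (klTempScaleIdx β klE0) μ K' →
      (∀ j < n + 1, histV15 L M klEngGeo5 P (klEngQ5 P R) R β U μ K' j) → frameDist K K' ≤ d → ∀ θ : ℝ,
      |((symInterp L (klLocSelfEnergyRe L M β U μ K (n + 1))).eval (klFermiPoint μ K' θ) -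
          (symInterp L (klLocSelfEnergyRe L M β U μ K n)).eval (klFermiPoint μ K' θ)) -
        ((symInterp L (klLocSelfEnergyRe L M β U μ K' (n + 1))).eval (klFermiPoint μ K' θ) -
          (symInterp L (klLocSelfEnergyRe L M β U μ K' n)).eval (klFermiPoint μ K' θ))| ≤ ρΔ * frameDist K K')
    (hvK' : ∀ K' : TrigPolyC4v, FrameOKDeg R U (klTempScaleIdx β klE0) μ K' →
      (∀ j < n + 1, histV15 L M klEngGeo5 P (klEngQ5 P R) R β U μ K' j) → ∀ θ : ℝ,
      |(symInterp L (klLocSelfEnergyRe L M β U μ K' (n + 1))).eval (klFermiPoint μ K' θ) -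
        (symInterp L (klLocSelfEnergyRe L M β U μ K' n)).eval (klFermiPoint μ K' θ)| ≤ Mv 0)
    (hfitL : ρΔ + bΔ / klCurveD ≤ lipBar klEngGeo5 (klEngQ5 P R) U (n + 1))
    (hfar : 2 * Mv 0 ≤ lipBar klEngGeo5 (klEngQ5 P R) U (n + 1) * d)
    (hz : ∀ k ∈ klShell L μ K (n + 1), |klFieldStrength L M β U μ K (n + 1) k - 1| ≤ R.cz * |U|)
    {m₁' : ℝ}
    (hm₁' : ∀ q : Momentum, |frameLevel μ K q| ≤ klScale klE0 (n + 1) →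
      ‖fderiv ℝ (evalM (symInterp L (fun p => klLocSelfEnergyRe L M β U μ K (n + 1) p - K.eval (latticeMomentum L p)))) q‖ ≤ m₁')
    (hfit1 : m₁' + 4 / 3 * R.Gfr 1 * U ^ 2 ≤ R.cz * |U| * (cDtmin (-1.2) (-0.05) / 2))
    -- (B) the multi-slot sizes at scale `n + 1`, by name
    (hms : TwoLegSizesMSTQ L M klEngGeo5 (klEngQ5 P R) R β U μ K (n + 1))
    -- (C) the two nested-leg rates at scale `n + 1`
    (hcut : ∀ (Mq : ℕ → ℕ) (L₁ M₁ M₂ : ℕ) [NeZero L₁] [NeZero M₁] [NeZero M₂], L ≤ L₁ → (klEngQ5 P R).M0 β L₁ ≤ M₁ → Mq L₁ ≤ M₁ → M₁ ≤ M₂ →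
      (∀ j < n + 1, histV15 L₁ M₁ klEngGeo5 P (klEngQ5 P R) R β U μ K j ∧
        TwoLegCoreTD L₁ M₁ (histV15 L₁ M₁ klEngGeo5 P (klEngQ5 P R) R β U μ) klEngGeo5 P (klEngQ5 P R) R β U μ K j ∧
          TwoLegSizesMSTQ L₁ M₁ klEngGeo5 (klEngQ5 P R) R β U μ K j) →
      (∀ j < n + 1, histV15 L₁ M₂ klEngGeo5 P (klEngQ5 P R) R β U μ K j ∧
        TwoLegCoreTD L₁ M₂ (histV15 L₁ M₂ klEngGeo5 P (klEngQ5 P R) R β U μ) klEngGeo5 P (klEngQ5 P R) R β U μ K j ∧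
          TwoLegSizesMSTQ L₁ M₂ klEngGeo5 (klEngQ5 P R) R β U μ K j) →
        ∀ θ : ℝ, |klLocalPart L₁ M₁ β U μ K (n + 1) θ - klLocalPart L₁ M₂ β U μ K (n + 1) θ| ≤ (klEngQ5 P R).CL β (n + 1) / 4 / L₁)
    (hsp : ∀ (Mq : ℕ → ℕ) (L₁ L₂ M₂ : ℕ) [NeZero L₁] [NeZero L₂] [NeZero M₂], L ≤ L₁ → L₁ ∣ L₂ → (klEngQ5 P R).M0 β L₁ ≤ M₂ → Mq L₁ ≤ M₂ →
      (klEngQ5 P R).M0 β L₂ ≤ M₂ → Mq L₂ ≤ M₂ →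
      (∀ j < n + 1, histV15 L₁ M₂ klEngGeo5 P (klEngQ5 P R) R β U μ K j ∧
        TwoLegCoreTD L₁ M₂ (histV15 L₁ M₂ klEngGeo5 P (klEngQ5 P R) R β U μ) klEngGeo5 P (klEngQ5 P R) R β U μ K j ∧
          TwoLegSizesMSTQ L₁ M₂ klEngGeo5 (klEngQ5 P R) R β U μ K j) →
      (∀ j < n + 1, histV15 L₂ M₂ klEngGeo5 P (klEngQ5 P R) R β U μ K j ∧
        TwoLegCoreTD L₂ M₂ (histV15 L₂ M₂ klEngGeo5 P (klEngQ5 P R) R β U μ) klEngGeo5 P (klEngQ5 P R) R β U μ K j ∧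
          TwoLegSizesMSTQ L₂ M₂ klEngGeo5 (klEngQ5 P R) R β U μ K j) →
        ∀ θ : ℝ, |klLocalPart L₁ M₂ β U μ K (n + 1) θ - klLocalPart L₂ M₂ β U μ K (n + 1) θ| ≤ (klEngQ5 P R).CL β (n + 1) / 4 / L₁) :
    TwoLegStepV16 L M klEngGeo5 P (klEngQ5 P R) R β U μ K (n + 1) := by
  have _ := hP; have _ := hn; have _ := hreg; have _ := hhist; have _ := hE; have _ := hM
  have hcore : TwoLegCoreTD L M (histV15 L M klEngGeo5 P (klEngQ5 P R) R β U μ) klEngGeo5 P (klEngQ5 P R) R β U μ K (n + 1) :=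
    twoLegCoreTD_succ_of_tubeSizes_stub7 (L := L) (M := M) P hR hc hc3 hU hUle hβ hβc hμ hK hL
      (histV15 L M klEngGeo5 P (klEngQ5 P R) R β U μ) n hMv hfitS hd hbΔ hg hr hvK' hfitL hfar hz hm₁' hfit1
  exact twoLegStepV16_of_namedCores_stub hcore hms hcut hsp

end Summit.HubbardSuperconductivity.HubbardSuperconductivity.Theorems.EngineV8

end
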